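import Summits.CriticalPhenomena.Ising3DConformalLimit.Theses.PerfectScreening
import Summits.CriticalPhenomena.Ising3DConformalLimit.Theorems.PerfectScreeningSubharmonicOffOriginPskDefs
import Summits.CriticalPhenomena.Ising3DConformalLimit.Theorems.PerfectScreeningSubharmonicOffOriginStubMassiveGreenPoisson
import Summits.CriticalPhenomena.Ising3DConformalLimit.Theorems.PerfectScreeningSubharmonicOffOriginStubMassiveGreenNonneg
import Summits.CriticalPhenomena.Ising3DConformalLimit.Theorems.PerfectScreeningSubharmonicOffOriginStubMixtureSubharmonic
import HarnessLib

/-!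
# Line `SketchIdeator1` of the crux `SubharmonicOffOrigin` (stmt-CriticalPhenomena-1341): the unconditional reduction

The three support stubs of the line are landed (`stub_massiveGreen_poisson` p120175, `stub_massiveGreen_nonneg` p120188,
`stub_mixture_subharmonic` p120371); this file discharges their antecedents against each other and records the line's
kernel-checked content as two hypothesis-free theorems:

* `massiveGreen_nonneg_three` — the lattice Yukawa potential `(s − Δ)⁻¹δ₀` of `ℤ³` is nonnegative for every `s ≥ 0`;
* `subharmonicOffOrigin_of_planarSourceMixture` — **`PlanarSourceMixture → SubharmonicOffOrigin`**: if the critical two-point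
  function of `ℤ³` is a positive superposition of lattice Yukawa potentials sourced on a coordinate plane, it is
  lattice-subharmonic off the origin (the crux, by name).

The transfer target `PlanarSourceMixture` itself is analysed FALSE at small mass (lead's `Lines/SketchIdeator1.dead.md`), so this
reduction does not close the item; it is the reusable residue of the line.
-/

noncomputable section

open Literature.Probability.LatticeModels
open Summit.CriticalPhenomena.Ising3DConformalLimit.Theses.PerfectScreening

namespace Summit.CriticalPhenomena.Ising3DConformalLimit.Theorems.PerfectScreening.Psk

/-- The lattice Yukawa potential of `ℤ³` is nonnegative for every mass parameter `s ≥ 0`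
(`stub_massiveGreen_nonneg` with its Poisson antecedent discharged by `stub_massiveGreen_poisson`). -/
theorem massiveGreen_nonneg_three : ∀ s : ℝ, 0 ≤ s → ∀ x : Site 3, 0 ≤ massiveGreen s x :=
  stub_massiveGreen_nonneg stub_massiveGreen_poisson

/-- **The reduction of line `SketchIdeator1`**: a planar-source mixture representation of `criticalTwoPoint 3` implies the
crux `SubharmonicOffOrigin` (positivity and the massive Poisson identity of the summands make the mixture subharmonic off
the source plane; cubic symmetry moves the plane). -/
theorem subharmonicOffOrigin_of_planarSourceMixture : PlanarSourceMixture → SubharmonicOffOrigin :=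
  stub_mixture_subharmonic massiveGreen_nonneg_three stub_massiveGreen_poisson

end Summit.CriticalPhenomena.Ising3DConformalLimit.Theorems.PerfectScreening.Psk

end
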